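import Mathlib
import HarnessLib
import Summits.HubbardSuperconductivity.Statement
import Literature.MathematicalPhysics.QuantumLattice.KohnLuttinger
import Literature.MathematicalPhysics.QuantumLattice.DWaveSource
import Summits.HubbardSuperconductivity.HubbardSuperconductivity.Theorems.ThermalWedgeTwSeededRungThermalWindow

/-!
# Sketch — crux `TwThermalWindowRungGlue` (stmt-HubbardSuperconductivity-15417), crux-ideate round 1, ideator 2

First lemmas of the idea cards, stated over existing declarations (nothing here is proposed to the
tree). The farm olean of the live module `Summits.….Theses.ThermalWedge` predates route rev 7 (the crux
decl and `TwSeededEnsembleEquivalenceR` are unknown identifiers when importing it, checked 2026-08-16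
~16:00Z), so — exactly as the crux-attack refuter's TW.lean did — section `Inlined` re-declares the four
relevant route decls with bodies copied VERBATIM (by script) from Theses/ThermalWedge.lean rev 9, under
the route file's own `open` lines. When the farm snapshot catches up, replace section `Inlined` by
`import Summits.HubbardSuperconductivity.HubbardSuperconductivity.Theses.ThermalWedge` +
`open Summit.HubbardSuperconductivity.HubbardSuperconductivity.Theses.ThermalWedge`; nothing else changes.
-/

set_option linter.dupNamespace false

namespace Summit.HubbardSuperconductivity.HubbardSuperconductivity.Cruxes.TwThermalWindowRungGlue.Sketch

open scoped BigOperators Topology Manifold Classical MeasureTheory ProbabilityTheory Matrix InnerProductSpace ComplexConjugate ContinuousMap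
open Filter Set Function TopologicalSpace MeasureTheory
open Literature.Hubbard

section Inlined
/-! Verbatim copies (rev 9) of the route decls `TwSourcedCondensation` (stmt-1697),
`TwSeededEnsembleEquivalenceR` (stmt-15581), `TwSeededRung` (stmt-1699), `TwThermalWindowRungGlue`
(stmt-15417, THE CRUX). -/

/-- verbatim copy of the route decl (rev 9). -/
def TwSourcedCondensation : Prop :=
  ∀ μ₁ μ₂ : ℝ, -4 < μ₁ → μ₁ ≤ μ₂ → μ₂ < 0 → ∃ U₀ a c C h₀ : ℝ, 0 < U₀ ∧ 0 < a ∧ 0 < c ∧ 0 < C ∧ 0 < h₀ ∧ ∀ U : ℝ, 0 < U → U ≤ U₀ → ∀ β : ℝ, 1 ≤ β → β ≤ Real.exp (a / U) → ∀ μ ∈ Set.Icc μ₁ μ₂, ∃ L₀ : ℕ, ∀ (L : ℕ) [NeZero L], L₀ ≤ L → ∀ h : ℝ, |h| ≤ h₀ → c * h ^ 2 * Real.log (1 / (|h| + 1 / β)) - C * h ^ 2 ≤ (Real.log (Matrix.partitionFn β (Literature.MathematicalPhysics.QuantumLattice.dWaveSourceTorus L U μ h)).re / (β * (L : ℝ)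 ^ 2)) - (Real.log (Matrix.partitionFn β (Literature.MathematicalPhysics.QuantumLattice.dWaveSourceTorus L U μ 0)).re / (β * (L : ℝ) ^ 2))

/-- verbatim copy of the route decl (rev 9). -/
def TwSeededEnsembleEquivalenceR : Prop :=
  ∀ δ ∈ Set.Icc (1/10 : ℝ) (2/5 : ℝ), ∃ μ₁ μ₂ : ℝ, -4 < μ₁ ∧ μ₁ ≤ μ₂ ∧ μ₂ < 0 ∧ ∃ a K' U₀ : ℝ, 0 < a ∧ 0 < K' ∧ 0 < U₀ ∧ ∀ U ∈ Set.Ioc (0 : ℝ) U₀, ∀ g ∈ Set.Icc (K' * U) (1 / 10), ∀ β : ℝ, 1 ≤ β → β ≤ Real.exp (a / U) → ∃ μ ∈ Set.Icc μ₁ μ₂, ∀ ε : ℝ, 0 < ε → ∃ L₀ : ℕ, ∀ (L : ℕ) [NeZero L], L₀ ≤ L → (((Literature.MathematicalPhysics.QuantumLattice.hubbardTorus 2 L 1 U - ((g / (L : ℝ) ^ 2 : ℝ) : ℂ) • ((Literature.MathematicalPhysics.QuantumLattice.pairField Literature.MathematicalPhysics.QuantumLattice.dWaveFormFactor L)ᴴ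 * Literature.MathematicalPhysics.QuantumLattice.pairField Literature.MathematicalPhysics.QuantumLattice.dWaveFormFactor L))).minEnergyOn (Literature.MathematicalPhysics.QuantumLattice.szSector (Λ := Literature.MathematicalPhysics.QuantumLattice.FermionTorus 2 L) (2 * ⌊(1 - δ) * (L : ℝ) ^ 2 / 2⌋₊) 0) / (L : ℝ) ^ 2) + (Real.log (Matrix.partitionFn β (Literature.MathematicalPhysics.QuantumLattice.hubbardTorusWith 2 L 1 U μ - ((g / (L : ℝ) ^ 2 : ℝ) : ℂ) • ((Literature.MathematicalPhysics.QuantumLattice.pairField Literature.MathematicalPhysics.QuantumLattice.dWaveFormFactor L)ᴴ * Literature.MathematicalPhysics.QuantumLattice.pairField Literature.MathematicalPhysics.QuantumLattice.dWaveFormFactor L))).re / (β * (L : ℝ) ^ 2)) - μ * ((2 * ⌊(1 - δ) * (L : ℝ) ^ 2 / 2⌋₊) : ℝ) / (L : ℝ) ^ 2 ≤ Real.log 4 / β + ε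

/-- verbatim copy of the route decl (rev 9). -/
def TwSeededRung : Prop :=
  ∀ δ ∈ Set.Icc (1/10 : ℝ) (2/5 : ℝ), ∃ U₀ K : ℝ, 0 < U₀ ∧ 0 < K ∧ K * U₀ ≤ 1 / 20 ∧ ∀ U ∈ Set.Ioc (0 : ℝ) U₀, (∀ g ∈ Set.Icc (K * U) (1 / 10), ∃ c : ℝ, 0 < c ∧ ∃ L₀ : ℕ, ∀ (L : ℕ) [NeZero L], L₀ ≤ L → Even L → ∀ (ψ : Literature.MathematicalPhysics.QuantumLattice.Fock (Literature.MathematicalPhysics.QuantumLattice.Orb (Literature.MathematicalPhysics.QuantumLattice.FermionTorus 2 L))), star ψ ⬝ᵥ ψ = 1 → Literature.MathematicalPhysics.QuantumLattice.IsGroundStateInSector (Literature.MathematicalPhysics.QuantumLattice.hubbardTorus 2 L 1 U - ((g / (L : ℝ) ^ 2 : ℝ) : ℂ) • ((Literature.MathematicalPhysics.QuantumLattice.pairField Literature.MathematicalPhysics.QuantumLattice.dWaveFormFactor L)ᴴ * Literature.MathematicalPhysics.QuantumLattice.pairField Literature.MathematicalPhysics.QuantumLattice.dWaveFormFactor L))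 (2 * ⌊(1 - δ) * (L : ℝ) ^ 2 / 2⌋₊) 0 ψ → c * (L : ℝ) ^ 4 ≤ (Literature.MathematicalPhysics.QuantumLattice.expect ((Literature.MathematicalPhysics.QuantumLattice.pairField Literature.MathematicalPhysics.QuantumLattice.dWaveFormFactor L)ᴴ * Literature.MathematicalPhysics.QuantumLattice.pairField Literature.MathematicalPhysics.QuantumLattice.dWaveFormFactor L) ψ).re)

/-- verbatim copy of the route decl (rev 9) — THE CRUX. -/
def TwThermalWindowRungGlue : Prop :=
  TwSeededEnsembleEquivalenceR → TwSourcedCondensation → ∀ δ ∈ Set.Icc (1/10 : ℝ) (2/5 : ℝ), ∃ U₀ K : ℝ, 0 < U₀ ∧ 0 < K ∧ K * U₀ ≤ 1 / 20 ∧ ∀ U ∈ Set.Ioc (0 : ℝ) U₀, (∀ g ∈ Set.Icc (K * U) (1 / 10), ∃ c : ℝ, 0 < c ∧ ∃ L₀ : ℕ, ∀ (L : ℕ) [NeZero L], L₀ ≤ L → Even L → ∀ (ψ : Literature.MathematicalPhysics.QuantumLattice.Fock (Literature.MathematicalPhysics.QuantumLattice.Orb (Literature.MathematicalPhysics.QuantumLattice.FermionTorus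 2 L))), star ψ ⬝ᵥ ψ = 1 → Literature.MathematicalPhysics.QuantumLattice.IsGroundStateInSector (Literature.MathematicalPhysics.QuantumLattice.hubbardTorus 2 L 1 U - ((g / (L : ℝ) ^ 2 : ℝ) : ℂ) • ((Literature.MathematicalPhysics.QuantumLattice.pairField Literature.MathematicalPhysics.QuantumLattice.dWaveFormFactor L)ᴴ * Literature.MathematicalPhysics.QuantumLattice.pairField Literature.MathematicalPhysics.QuantumLattice.dWaveFormFactor L)) (2 * ⌊(1 - δ) * (L : ℝ) ^ 2 / 2⌋₊) 0 ψ → c * (L : ℝ) ^ 4 ≤ (Literature.MathematicalPhysics.QuantumLattice.expect ((Literature.MathematicalPhysics.QuantumLattice.pairField Literature.MathematicalPhysics.QuantumLattice.dWaveFormFactor L)ᴴ * Literature.MathematicalPhysics.QuantumLattice.pairField Literature.MathematicalPhysics.QuantumLattice.dWaveFormFactor L) ψ).re)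

end Inlined

open Summit.HubbardSuperconductivity.HubbardSuperconductivity.Theorems

/-- Card `engine-fold-port` — sanity: the crux's inlined conclusion is the anchor `TwSeededRung`
verbatim, so the crux is, up to unfolding, `R → C → TwSeededRung`. -/
example : TwThermalWindowRungGlue =
    (TwSeededEnsembleEquivalenceR → TwSourcedCondensation → TwSeededRung) := rfl

/-- Card `engine-fold-port` — FIRST LEMMA (= the whole line): the crux is the landed engine
`twSeededRung_structural_thermalWindow` (Theorems/ThermalWedgeTwSeededRungThermalWindow.lean, p97295)
with the three route defs folded (delta-unfolding only; both hypotheses are consumed inside the engine: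
`a := min aᵉ aᶜ`, `K := max (16/(c a)) K'`). -/
theorem firstLemma_foldPort : TwThermalWindowRungGlue :=
  fun hE hC => twSeededRung_structural_thermalWindow hE hC

/-- Same, tactic form (the variant to use if term-mode unification ever balks after a restatement that
keeps the bodies α-equivalent but not syntactically identical). -/
theorem firstLemma_foldPort' : TwThermalWindowRungGlue := by
  intro hE hC δ hδ
  exact twSeededRung_structural_thermalWindow hE hC δ hδ

/-- Card `engine-fold-port` — DRIFT FALLBACK: were a later `route edit --restate` to move the bodies of
`TwSeededEnsembleEquivalenceR` / `TwSourcedCondensation` off the engine's frozen hypotheses, the anchor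
still closes by real arithmetic against the PARAMETRIC kernel `twSeededRung_of_probe`
(Theorems/ThermalWedgeTwSeededRungMaster.lean): ANY probe schedule `(β_L, μ_L, s_L)` with a positive
margin `m(U,g)` gives the anchor with `c = m/g`. Its conclusion is the anchor verbatim: -/
theorem fallback_probeKernel_concludes_anchor
    (H : ∀ δ ∈ Set.Icc (1/10 : ℝ) (2/5 : ℝ), ∃ U₀ K : ℝ, 0 < U₀ ∧ 0 < K ∧ K * U₀ ≤ 1 / 20 ∧
      ∀ U ∈ Set.Ioc (0 : ℝ) U₀, ∀ g ∈ Set.Icc (K * U) (1 / 10), ∃ m : ℝ, 0 < m ∧ ∃ L₀ : ℕ,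
        ∀ (L : ℕ) [NeZero L], L₀ ≤ L → Even L → ∃ β μ s : ℝ, 0 < β ∧
          m ≤ (Real.log (Matrix.partitionFn β (Literature.MathematicalPhysics.QuantumLattice.dWaveSourceTorus L U μ s)).re / (β * (L : ℝ) ^ 2) -
                Real.log (Matrix.partitionFn β (Literature.MathematicalPhysics.QuantumLattice.dWaveSourceTorus L U μ 0)).re / (β * (L : ℝ) ^ 2)) -
              s ^ 2 / g -
              ((Literature.MathematicalPhysics.QuantumLattice.hubbardTorus 2 L 1 U - ((g / (L : ℝ) ^ 2 : ℝ) : ℂ) •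
                    ((Literature.MathematicalPhysics.QuantumLattice.pairField Literature.MathematicalPhysics.QuantumLattice.dWaveFormFactor L)ᴴ *
                      Literature.MathematicalPhysics.QuantumLattice.pairField Literature.MathematicalPhysics.QuantumLattice.dWaveFormFactor L)).minEnergyOn
                  (Literature.MathematicalPhysics.QuantumLattice.szSector (Λ := Literature.MathematicalPhysics.QuantumLattice.FermionTorus 2 L) (2 * ⌊(1 - δ) * (L : ℝ) ^ 2 / 2⌋₊) 0) /
                    (L : ℝ) ^ 2 +
                Real.log (Matrix.partitionFn β (Literature.MathematicalPhysics.QuantumLattice.hubbardTorusWith 2 L 1 U μ -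
                  ((g / (L : ℝ) ^ 2 : ℝ) : ℂ) •
                    ((Literature.MathematicalPhysics.QuantumLattice.pairField Literature.MathematicalPhysics.QuantumLattice.dWaveFormFactor L)ᴴ *
                      Literature.MathematicalPhysics.QuantumLattice.pairField Literature.MathematicalPhysics.QuantumLattice.dWaveFormFactor L))).re /
                    (β * (L : ℝ) ^ 2) -
                μ * ((2 * ⌊(1 - δ) * (L : ℝ) ^ 2 / 2⌋₊ : ℕ) : ℝ) / (L : ℝ) ^ 2)) :
    TwSeededRung :=
  twSeededRung_of_probe H

end Summit.HubbardSuperconductivity.HubbardSuperconductivity.Cruxes.TwThermalWindowRungGlue.Sketch
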